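import Literature.NumberTheory.LFunctions.Zhang2022.KnifeEdgeLenZDegreeAtomsLemmas

/-!
# Zhang (2022), rung F-S3 (Landau–Siegel programme, §D edge len = E*-len⁺): route `ZDegreeToeplitzBand`, item α1 —
# HONEST INTEGRALS for the two-variable closed-form atoms `bulk` (= `kernelPair 1 1`) and `volt` (critic's debt D1, part 2)

Y. Zhang, *Discrete mean estimates and the Landau–Siegel zero*, arXiv:2211.02515v1 [Zhang2022LandauSiegel] — an
unrefereed manuscript under adjudication. **WHAT THIS IS NOT: not a claim about Theorems 1–2 of arXiv:2211.02515, about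
Landau–Siegel zeros, or about Parity. The programme SEARCHES and TYPES; no claim about Landau–Siegel zeros, Theorems 1–2
of arXiv:2211.02515 or a repaired Margin232 until a kernel theorem says so.** `E₀`-free (no instance of
`KnifeEdge.PsiGradedClosedForms` is constructed); sibling of `KnifeEdgeLenZDegreeAtomsLemmas` (split for the 400-line cap).

For the atoms `bulk K₀₀ K₀₁ K₁₀ K₁₁` (`∫₀¹∫₀¹`) and `volt K₀₀ K₀₁ K₁₀ K₁₁` (`∫₀¹∫₀ˣ`) of `KnifeEdgeLenZDegreeAtoms` with kernels
continuous on the CLOSED square (`ClosedFormAtom.KernelsContinuous`) and kinked legs (`Repair.KinkedProfile`):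
* for every `x ∈ [0,1]` the inner `y`-integrand `K₀₀(x,y)f(x)ḡ(y) + K₀₁ f(x)ḡ′(y) + K₁₀ f′(x)ḡ(y) + K₁₁ f′(x)ḡ′(y)` is
  integrable on `[0,1]` (resp. `[0,x]`) — `intervalIntegrable_kernelPair_inner`, `intervalIntegrable_volterraPair_inner`;
* the inner integral splits as `f(x)·I₀₀(x) + f(x)·I₀₁(x) + f′(x)·I₁₀(x) + f′(x)·I₁₁(x)` with the parametric integrals
  `I₀₀(x) = ∫ K₀₀(x,y)ḡ(y) dy`, `I₀₁(x) = ∫ K₀₁(x,y)ḡ′(y) dy`, … over `[0,1]` (resp. `[0,x]`), each CONTINUOUS on `[0,1]` by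
  `continuousOn_parametric_integral_unit` / `continuousOn_parametric_primitive_unit` (dominated convergence) —
  `kernelPair_inner_eq`, `volterraPair_inner_eq`;
* hence the OUTER `x`-integrand is integrable on `[0,1]` (`C⁰·C⁰` and `L²·C⁰`) — `intervalIntegrable_kernelPair_outer`,
  `intervalIntegrable_volterraPair_outer`: both iterated interval integrals are values, not Lean's junk `0` (pin (b″));
* and on kinked legs the atoms ARE the single honest integrals `∫₀¹ (f·I₀₀ + f·I₀₁ + f′·I₁₀ + f′·I₁₁)` —
  `ClosedFormAtom.eval_bulk_apply_eq`, `ClosedFormAtom.eval_volt_apply_eq` (no Fubini needed, no side condition left).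

Typer: ls-knife-typer-3 g8 (cell landau-siegel §D; WAKE ls-lead g3 08:16:01Z (2); critic ls-knife-crit-1 g5 C1 CONFIRM —
SCHEMA 07:30:56Z ask D1).

## References
* Y. Zhang, arXiv:2211.02515v1 (2022), §7 Prop. 7.1 (7.2); §8 (8.5), (8.11)–(8.12).
  [cite: Zhang2022LandauSiegel, §7 Prop 7.1 (7.2), §8 (8.5), (8.11)–(8.12)]
-/

noncomputable section

open Complex Real ComplexConjugate Set MeasureTheory Filter
open scoped Topology Interval

namespace Literature.NumberTheory.LFunctions.Zhang2022

namespace KnifeEdge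

open Repair Skeleton

/-! ### Honest integrals for the two-variable atoms `bulk` and `volt` -/

section BulkVolt

variable {K₀₀ K₀₁ K₁₀ K₁₁ : ℝ → ℝ → ℂ} {f f' g g' : ℝ → ℂ}

/-- Linearity of `∫ₐᵇ` over four weighted integrable terms. [folklore] -/
private theorem integral_lin4 {φ₁ φ₂ φ₃ φ₄ : ℝ → ℂ} (c₁ c₂ c₃ c₄ : ℂ) {a b : ℝ}
    (h1 : IntervalIntegrable φ₁ volume a b) (h2 : IntervalIntegrable φ₂ volume a b)
    (h3 : IntervalIntegrable φ₃ volume a b) (h4 : IntervalIntegrable φ₄ volume a b) :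
    ∫ y in a..b, (c₁ * φ₁ y + c₂ * φ₂ y + c₃ * φ₃ y + c₄ * φ₄ y)
      = c₁ * (∫ y in a..b, φ₁ y) + c₂ * (∫ y in a..b, φ₂ y)
        + c₃ * (∫ y in a..b, φ₃ y) + c₄ * (∫ y in a..b, φ₄ y) := by
  rw [intervalIntegral.integral_add ((h1.const_mul c₁).add ((h2.const_mul c₂))|>.add (h3.const_mul c₃))
      (h4.const_mul c₄),
    intervalIntegral.integral_add ((h1.const_mul c₁).add (h2.const_mul c₂)) (h3.const_mul c₃),
    intervalIntegral.integral_add (h1.const_mul c₁) (h2.const_mul c₂),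
    intervalIntegral.integral_const_mul, intervalIntegral.integral_const_mul,
    intervalIntegral.integral_const_mul, intervalIntegral.integral_const_mul]

/-- The conjugate second leg `conj g` of a kinked profile is integrable on `[0,1]`. [cite: Zhang2022LandauSiegel, §7 Prop 7.1 (7.2)] -/
theorem intervalIntegrable_conj_of_kinked (hg : KinkedProfile g g') :
    IntervalIntegrable (fun y => conj (g y)) volume 0 1 :=
  (continuousOn_conj_comp hg.cont).intervalIntegrable_of_Icc zero_le_one

/-- … and so is its derivative leg `conj g′` (`L² ⊂ L¹`). [cite: Zhang2022LandauSiegel, §7 Prop 7.1 (7.2)] -/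
theorem intervalIntegrable_conj_deriv_of_kinked (hg : KinkedProfile g g') :
    IntervalIntegrable (fun y => conj (g' y)) volume 0 1 := by
  have := hg.isH1.intervalIntegrable
  rw [intervalIntegrable_iff] at this ⊢
  exact (Complex.conjLIE.toContinuousLinearMap.integrable_comp this : _)

/-- **Inner honest integral for `bulk` (`kernelPair 1 1`):** for every `x ∈ [0,1]` the `y`-integrand
`K₀₀(x,y)f(x)ḡ(y) + K₀₁ f(x)ḡ′(y) + K₁₀ f′(x)ḡ(y) + K₁₁ f′(x)ḡ′(y)` is integrable on `[0,1]` (kernels continuous on the closed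
square, second leg kinked; `f(x), f′(x)` are constants here). [cite: Zhang2022LandauSiegel, §7 Prop 7.1 (7.2)] -/
theorem intervalIntegrable_kernelPair_inner (h₀₀ : ContinuousOn (Function.uncurry K₀₀) (Icc 0 1 ×ˢ Icc 0 1))
    (h₀₁ : ContinuousOn (Function.uncurry K₀₁) (Icc 0 1 ×ˢ Icc 0 1))
    (h₁₀ : ContinuousOn (Function.uncurry K₁₀) (Icc 0 1 ×ˢ Icc 0 1))
    (h₁₁ : ContinuousOn (Function.uncurry K₁₁) (Icc 0 1 ×ˢ Icc 0 1)) (hg : KinkedProfile g g') (f f' : ℝ → ℂ)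
    {x : ℝ} (hx : x ∈ Icc (0:ℝ) 1) :
    IntervalIntegrable (fun y => K₀₀ x y * f x * conj (g y) + K₀₁ x y * f x * conj (g' y) +
      K₁₀ x y * f' x * conj (g y) + K₁₁ x y * f' x * conj (g' y)) volume 0 1 := by
  have hG := intervalIntegrable_conj_of_kinked hg
  have hG' := intervalIntegrable_conj_deriv_of_kinked hg
  have hsum := ((((intervalIntegrable_kernel_section_mul h₀₀ hG hx).const_mul (f x)).add
    ((intervalIntegrable_kernel_section_mul h₀₁ hG' hx).const_mul (f x))).add
    ((intervalIntegrable_kernel_section_mul h₁₀ hG hx).const_mul (f' x))).add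
    ((intervalIntegrable_kernel_section_mul h₁₁ hG' hx).const_mul (f' x))
  refine hsum.congr ?_
  intro y _
  simp only
  ring

/-- **The inner `bulk` integral splits:** for `x ∈ [0,1]`,
`∫₀¹ (…)(x,y) dy = f(x)·I₀₀(x) + f(x)·I₀₁(x) + f′(x)·I₁₀(x) + f′(x)·I₁₁(x)` with the parametric integrals
`I₀₀(x) = ∫₀¹ K₀₀(x,y)ḡ(y) dy`, `I₀₁(x) = ∫₀¹ K₀₁(x,y)ḡ′(y) dy`, `I₁₀`, `I₁₁` (each continuous on `[0,1]`,
`continuousOn_parametric_integral_unit`). [cite: Zhang2022LandauSiegel, §7 Prop 7.1 (7.2)] -/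
theorem kernelPair_inner_eq (h₀₀ : ContinuousOn (Function.uncurry K₀₀) (Icc 0 1 ×ˢ Icc 0 1))
    (h₀₁ : ContinuousOn (Function.uncurry K₀₁) (Icc 0 1 ×ˢ Icc 0 1))
    (h₁₀ : ContinuousOn (Function.uncurry K₁₀) (Icc 0 1 ×ˢ Icc 0 1))
    (h₁₁ : ContinuousOn (Function.uncurry K₁₁) (Icc 0 1 ×ˢ Icc 0 1)) (hg : KinkedProfile g g') (f f' : ℝ → ℂ)
    {x : ℝ} (hx : x ∈ Icc (0:ℝ) 1) :
    (∫ y in (0:ℝ)..1, (K₀₀ x y * f x * conj (g y) + K₀₁ x y * f x * conj (g' y) +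
      K₁₀ x y * f' x * conj (g y) + K₁₁ x y * f' x * conj (g' y))) =
      f x * (∫ y in (0:ℝ)..1, K₀₀ x y * conj (g y)) + f x * (∫ y in (0:ℝ)..1, K₀₁ x y * conj (g' y)) +
      f' x * (∫ y in (0:ℝ)..1, K₁₀ x y * conj (g y)) + f' x * (∫ y in (0:ℝ)..1, K₁₁ x y * conj (g' y)) := by
  have hG := intervalIntegrable_conj_of_kinked hg
  have hG' := intervalIntegrable_conj_deriv_of_kinked hg
  have hre : (fun y => K₀₀ x y * f x * conj (g y) + K₀₁ x y * f x * conj (g' y) +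
      K₁₀ x y * f' x * conj (g y) + K₁₁ x y * f' x * conj (g' y)) =
      fun y => f x * (K₀₀ x y * conj (g y)) + f x * (K₀₁ x y * conj (g' y)) +
        f' x * (K₁₀ x y * conj (g y)) + f' x * (K₁₁ x y * conj (g' y)) := by
    funext y; ring
  rw [hre]
  exact integral_lin4 (f x) (f x) (f' x) (f' x) (intervalIntegrable_kernel_section_mul h₀₀ hG hx)
    (intervalIntegrable_kernel_section_mul h₀₁ hG' hx) (intervalIntegrable_kernel_section_mul h₁₀ hG hx)
    (intervalIntegrable_kernel_section_mul h₁₁ hG' hx)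

/-- **Outer honest integral for `bulk` (`kernelPair 1 1`):** with kernels continuous on the closed square and kinked legs the
OUTER integrand `x ↦ ∫₀¹ (K₀₀ f(x)ḡ(y) + K₀₁ f(x)ḡ′(y) + K₁₀ f′(x)ḡ(y) + K₁₁ f′(x)ḡ′(y)) dy` is integrable on `[0,1]`: on `[0,1]`
it is `f·I₀₀ + f·I₀₁ + f′·I₁₀ + f′·I₁₁` (`kernelPair_inner_eq`) with the `I_{ij}` continuous (dominated convergence) and
`f ∈ C⁰`, `f′ ∈ L²`. So both iterated integrals of the `bulk` atom are values, not junk `0`.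
[cite: Zhang2022LandauSiegel, §7 Prop 7.1 (7.2)] -/
theorem intervalIntegrable_kernelPair_outer (h₀₀ : ContinuousOn (Function.uncurry K₀₀) (Icc 0 1 ×ˢ Icc 0 1))
    (h₀₁ : ContinuousOn (Function.uncurry K₀₁) (Icc 0 1 ×ˢ Icc 0 1))
    (h₁₀ : ContinuousOn (Function.uncurry K₁₀) (Icc 0 1 ×ˢ Icc 0 1))
    (h₁₁ : ContinuousOn (Function.uncurry K₁₁) (Icc 0 1 ×ˢ Icc 0 1))
    (hf : KinkedProfile f f') (hg : KinkedProfile g g') :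
    IntervalIntegrable (fun x => ∫ y in (0:ℝ)..1, (K₀₀ x y * f x * conj (g y) + K₀₁ x y * f x * conj (g' y) +
      K₁₀ x y * f' x * conj (g y) + K₁₁ x y * f' x * conj (g' y))) volume 0 1 := by
  have hG := intervalIntegrable_conj_of_kinked hg
  have hG' := intervalIntegrable_conj_deriv_of_kinked hg
  have hI : uIcc (0:ℝ) 1 = Icc 0 1 := uIcc_of_le zero_le_one
  have I₀₀ := continuousOn_parametric_integral_unit h₀₀ hG
  have I₀₁ := continuousOn_parametric_integral_unit h₀₁ hG'
  have I₁₀ := continuousOn_parametric_integral_unit h₁₀ hG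
  have I₁₁ := continuousOn_parametric_integral_unit h₁₁ hG'
  have e₁ := (hf.cont.mul I₀₀).intervalIntegrable_of_Icc (μ := volume) zero_le_one
  have e₂ := (hf.cont.mul I₀₁).intervalIntegrable_of_Icc (μ := volume) zero_le_one
  have e₃ := hf.isH1.intervalIntegrable.mul_continuousOn (by rw [hI]; exact I₁₀)
  have e₄ := hf.isH1.intervalIntegrable.mul_continuousOn (by rw [hI]; exact I₁₁)
  refine (((e₁.add e₂).add e₃).add e₄).congr ?_
  intro x hx
  rw [uIoc_of_le zero_le_one] at hx
  exact (kernelPair_inner_eq h₀₀ h₀₁ h₁₀ h₁₁ hg f f' (Ioc_subset_Icc_self hx)).symm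

/-- With honest integrands the `bulk` atom is, on kinked legs, the single honest integral
`∫₀¹ (f·I₀₀ + f·I₀₁ + f′·I₁₀ + f′·I₁₁)(x) dx` of `kernelPair_inner_eq` — no Fubini, no side condition left.
[cite: Zhang2022LandauSiegel, §7 Prop 7.1 (7.2)] -/
theorem ClosedFormAtom.eval_bulk_apply_eq (h₀₀ : ContinuousOn (Function.uncurry K₀₀) (Icc 0 1 ×ˢ Icc 0 1))
    (h₀₁ : ContinuousOn (Function.uncurry K₀₁) (Icc 0 1 ×ˢ Icc 0 1))
    (h₁₀ : ContinuousOn (Function.uncurry K₁₀) (Icc 0 1 ×ˢ Icc 0 1))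
    (h₁₁ : ContinuousOn (Function.uncurry K₁₁) (Icc 0 1 ×ˢ Icc 0 1)) (f f' : ℝ → ℂ) (hg : KinkedProfile g g') :
    (ClosedFormAtom.bulk K₀₀ K₀₁ K₁₀ K₁₁).eval f f' g g' =
      ∫ x in (0:ℝ)..1, (f x * (∫ y in (0:ℝ)..1, K₀₀ x y * conj (g y)) + f x * (∫ y in (0:ℝ)..1, K₀₁ x y * conj (g' y)) +
        f' x * (∫ y in (0:ℝ)..1, K₁₀ x y * conj (g y)) + f' x * (∫ y in (0:ℝ)..1, K₁₁ x y * conj (g' y))) := by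
  rw [ClosedFormAtom.eval_bulk]
  refine intervalIntegral.integral_congr fun x hx => ?_
  rw [uIcc_of_le zero_le_one] at hx
  exact kernelPair_inner_eq h₀₀ h₀₁ h₁₀ h₁₁ hg f f' hx

/-- **Inner honest integral for `volt` (triangle):** for `x ∈ [0,1]` the `y`-integrand is integrable on `[0,x]`.
[cite: Zhang2022LandauSiegel, §7 Prop 7.1 (7.2), (8.12)] -/
theorem intervalIntegrable_volterraPair_inner (h₀₀ : ContinuousOn (Function.uncurry K₀₀) (Icc 0 1 ×ˢ Icc 0 1))
    (h₀₁ : ContinuousOn (Function.uncurry K₀₁) (Icc 0 1 ×ˢ Icc 0 1))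
    (h₁₀ : ContinuousOn (Function.uncurry K₁₀) (Icc 0 1 ×ˢ Icc 0 1))
    (h₁₁ : ContinuousOn (Function.uncurry K₁₁) (Icc 0 1 ×ˢ Icc 0 1)) (hg : KinkedProfile g g') (f f' : ℝ → ℂ)
    {x : ℝ} (hx : x ∈ Icc (0:ℝ) 1) :
    IntervalIntegrable (fun y => K₀₀ x y * f x * conj (g y) + K₀₁ x y * f x * conj (g' y) +
      K₁₀ x y * f' x * conj (g y) + K₁₁ x y * f' x * conj (g' y)) volume 0 x :=
  intervalIntegrable_mono_unit (intervalIntegrable_kernelPair_inner h₀₀ h₀₁ h₁₀ h₁₁ hg f f' hx) hx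

/-- **The inner `volt` integral splits:** for `x ∈ [0,1]`, `∫₀ˣ (…)(x,y) dy = f(x)·J₀₀(x) + f(x)·J₀₁(x) + f′(x)·J₁₀(x) +
f′(x)·J₁₁(x)` with the Volterra primitives `J₀₀(x) = ∫₀ˣ K₀₀(x,y)ḡ(y) dy`, … (each continuous on `[0,1]`,
`continuousOn_parametric_primitive_unit`). [cite: Zhang2022LandauSiegel, §7 Prop 7.1 (7.2), (8.12)] -/
theorem volterraPair_inner_eq (h₀₀ : ContinuousOn (Function.uncurry K₀₀) (Icc 0 1 ×ˢ Icc 0 1))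
    (h₀₁ : ContinuousOn (Function.uncurry K₀₁) (Icc 0 1 ×ˢ Icc 0 1))
    (h₁₀ : ContinuousOn (Function.uncurry K₁₀) (Icc 0 1 ×ˢ Icc 0 1))
    (h₁₁ : ContinuousOn (Function.uncurry K₁₁) (Icc 0 1 ×ˢ Icc 0 1)) (hg : KinkedProfile g g') (f f' : ℝ → ℂ)
    {x : ℝ} (hx : x ∈ Icc (0:ℝ) 1) :
    (∫ y in (0:ℝ)..x, (K₀₀ x y * f x * conj (g y) + K₀₁ x y * f x * conj (g' y) +
      K₁₀ x y * f' x * conj (g y) + K₁₁ x y * f' x * conj (g' y))) =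
      f x * (∫ y in (0:ℝ)..x, K₀₀ x y * conj (g y)) + f x * (∫ y in (0:ℝ)..x, K₀₁ x y * conj (g' y)) +
      f' x * (∫ y in (0:ℝ)..x, K₁₀ x y * conj (g y)) + f' x * (∫ y in (0:ℝ)..x, K₁₁ x y * conj (g' y)) := by
  have hG := intervalIntegrable_conj_of_kinked hg
  have hG' := intervalIntegrable_conj_deriv_of_kinked hg
  have hre : (fun y => K₀₀ x y * f x * conj (g y) + K₀₁ x y * f x * conj (g' y) +
      K₁₀ x y * f' x * conj (g y) + K₁₁ x y * f' x * conj (g' y)) =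
      fun y => f x * (K₀₀ x y * conj (g y)) + f x * (K₀₁ x y * conj (g' y)) +
        f' x * (K₁₀ x y * conj (g y)) + f' x * (K₁₁ x y * conj (g' y)) := by
    funext y; ring
  rw [hre]
  exact integral_lin4 (f x) (f x) (f' x) (f' x)
    (intervalIntegrable_mono_unit (intervalIntegrable_kernel_section_mul h₀₀ hG hx) hx)
    (intervalIntegrable_mono_unit (intervalIntegrable_kernel_section_mul h₀₁ hG' hx) hx)
    (intervalIntegrable_mono_unit (intervalIntegrable_kernel_section_mul h₁₀ hG hx) hx)
    (intervalIntegrable_mono_unit (intervalIntegrable_kernel_section_mul h₁₁ hG' hx) hx)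

/-- **Outer honest integral for `volt`:** the OUTER integrand `x ↦ ∫₀ˣ (…)(x,y) dy` is integrable on `[0,1]` (on `[0,1]` it is
`f·J₀₀ + f·J₀₁ + f′·J₁₀ + f′·J₁₁` with the Volterra primitives continuous). So both iterated integrals of the `volt` atom
are values, not junk `0`. [cite: Zhang2022LandauSiegel, §7 Prop 7.1 (7.2), (8.12)] -/
theorem intervalIntegrable_volterraPair_outer (h₀₀ : ContinuousOn (Function.uncurry K₀₀) (Icc 0 1 ×ˢ Icc 0 1))
    (h₀₁ : ContinuousOn (Function.uncurry K₀₁) (Icc 0 1 ×ˢ Icc 0 1))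
    (h₁₀ : ContinuousOn (Function.uncurry K₁₀) (Icc 0 1 ×ˢ Icc 0 1))
    (h₁₁ : ContinuousOn (Function.uncurry K₁₁) (Icc 0 1 ×ˢ Icc 0 1))
    (hf : KinkedProfile f f') (hg : KinkedProfile g g') :
    IntervalIntegrable (fun x => ∫ y in (0:ℝ)..x, (K₀₀ x y * f x * conj (g y) + K₀₁ x y * f x * conj (g' y) +
      K₁₀ x y * f' x * conj (g y) + K₁₁ x y * f' x * conj (g' y))) volume 0 1 := by
  have hG := intervalIntegrable_conj_of_kinked hg
  have hG' := intervalIntegrable_conj_deriv_of_kinked hg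
  have hI : uIcc (0:ℝ) 1 = Icc 0 1 := uIcc_of_le zero_le_one
  have J₀₀ := continuousOn_parametric_primitive_unit h₀₀ hG
  have J₀₁ := continuousOn_parametric_primitive_unit h₀₁ hG'
  have J₁₀ := continuousOn_parametric_primitive_unit h₁₀ hG
  have J₁₁ := continuousOn_parametric_primitive_unit h₁₁ hG'
  have e₁ := (hf.cont.mul J₀₀).intervalIntegrable_of_Icc (μ := volume) zero_le_one
  have e₂ := (hf.cont.mul J₀₁).intervalIntegrable_of_Icc (μ := volume) zero_le_one
  have e₃ := hf.isH1.intervalIntegrable.mul_continuousOn (by rw [hI]; exact J₁₀)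
  have e₄ := hf.isH1.intervalIntegrable.mul_continuousOn (by rw [hI]; exact J₁₁)
  refine (((e₁.add e₂).add e₃).add e₄).congr ?_
  intro x hx
  rw [uIoc_of_le zero_le_one] at hx
  exact (volterraPair_inner_eq h₀₀ h₀₁ h₁₀ h₁₁ hg f f' (Ioc_subset_Icc_self hx)).symm

/-- With honest integrands the `volt` atom is, on kinked legs, the single honest integral
`∫₀¹ (f·J₀₀ + f·J₀₁ + f′·J₁₀ + f′·J₁₁)(x) dx`. [cite: Zhang2022LandauSiegel, §7 Prop 7.1 (7.2), (8.12)] -/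
theorem ClosedFormAtom.eval_volt_apply_eq (h₀₀ : ContinuousOn (Function.uncurry K₀₀) (Icc 0 1 ×ˢ Icc 0 1))
    (h₀₁ : ContinuousOn (Function.uncurry K₀₁) (Icc 0 1 ×ˢ Icc 0 1))
    (h₁₀ : ContinuousOn (Function.uncurry K₁₀) (Icc 0 1 ×ˢ Icc 0 1))
    (h₁₁ : ContinuousOn (Function.uncurry K₁₁) (Icc 0 1 ×ˢ Icc 0 1)) (f f' : ℝ → ℂ) (hg : KinkedProfile g g') :
    (ClosedFormAtom.volt K₀₀ K₀₁ K₁₀ K₁₁).eval f f' g g' =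
      ∫ x in (0:ℝ)..1, (f x * (∫ y in (0:ℝ)..x, K₀₀ x y * conj (g y)) + f x * (∫ y in (0:ℝ)..x, K₀₁ x y * conj (g' y)) +
        f' x * (∫ y in (0:ℝ)..x, K₁₀ x y * conj (g y)) + f' x * (∫ y in (0:ℝ)..x, K₁₁ x y * conj (g' y))) := by
  rw [ClosedFormAtom.eval_volt]
  refine intervalIntegral.integral_congr fun x hx => ?_
  rw [uIcc_of_le zero_le_one] at hx
  exact volterraPair_inner_eq h₀₀ h₀₁ h₁₀ h₁₁ hg f f' hx

end BulkVolt

end KnifeEdge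

end Literature.NumberTheory.LFunctions.Zhang2022

end
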